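import Summits.BirchSwinnertonDyer.BirchSwinnertonDyer.Theorems.ManinLocalTwoThreeTranslationNewform
import Literature.NumberTheory.EllipticCurves.AtkinLehnerInvolutionsNewformProofs
import Literature.NumberTheory.EllipticCurves.BSDHeegnerPointsTorsionProofs
import Literature.NumberTheory.Automorphic.ShimuraCurveRibetTakahashiPeterssonTwistComparisonProofs
import HarnessLib

/-!
# E-an-44: the Atkin–Lehner sign at `4 ∥ N` is `λ₄ = −1` (`w₄ f = −f` for every newform `f` on `Γ₀(4M)`, `M` odd)

Summit `BirchSwinnertonDyer`, route `ManinLocalTwoThree` (cell bsd-f2-manin), crux C2 `ManinOddAtFour`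
(stmt-BirchSwinnertonDyer-22967); analytic lens row E-an-44 (MEMO-an §52/§55: the level-four sign package; refuter-1 §R46:
«THEOREM — λ₄ = −1 ⟸ f ∣ t = −f ∧ (t w₄)³ ∈ ℚ^× Γ₀(4M), character of S₃»; in print for elliptic curves / local
representations, e.g. Knightly 2025 Prop. 5.1, but used by the cell's sketches only as the hypothesis
`AtkinLehnerSignAtFourExact`).  PROVED HERE: `atkinLehnerInvolution_four_eq_neg`.

THE ARGUMENT.  `w = w(4) = (4x, y; 4M, 4)` (`4x − My = 1`), `t = (2 1; 0 2)` (the half-translate, tree `halfTranslateGL`),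
`τ = w t`.  The matrix identity `τ³ = 64 · γ` with `γ ∈ Γ₀(4M)` explicit (`tau_cube_eq`), the newform relations
`f ∣₂ w = ε f` (`ε = ±1`, Knapp Thm 9.27) and `f ∣₂ t = −f` (`a_{2n}(f) = 0` at `4 ∣ N`, tree `cuspCoeff_halfTranslate_two`)
give `f = f ∣₂ τ³ = (−ε)³ f = −ε f`, so `ε = −1`.
Nothing about BSD, Manin's conjecture or any Manin constant is asserted or proved here.
-/

-- `Summit.BirchSwinnertonDyer.BirchSwinnertonDyer` is the mandated summit-side namespace (single-conjunct summit).
set_option linter.dupNamespace false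

noncomputable section

open scoped MatrixGroups ModularForm
open CongruenceSubgroup Matrix.SpecialLinearGroup UpperHalfPlane
open Literature.NumberTheory.EllipticCurves Literature.NumberTheory.EllipticCurves.ModularForms
open Summit.BirchSwinnertonDyer.Rank1Residual.ManinAdditive
open Summit.BirchSwinnertonDyer.Rank1Residual.ManinAdditive.ConwayCut

namespace Summit.BirchSwinnertonDyer.BirchSwinnertonDyer.Theorems.ManinLocalTwoThree

/-- **`t f = −f` for a newform at `4 ∣ N`**: the half-translate flips the sign of the odd coefficients and the even ones
vanish (`cuspCoeff_halfTranslate_two`, `IsNewform0.cuspCoeff_eq_zero_of_two_dvd`). [cite: AtkinLehner1970, Thm. 3] -/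
theorem halfTranslate_two_eq_neg_of_isNewform0 {N : ℕ} [NeZero N] (h4 : 4 ∣ N) (f : CuspForm (Gamma0 N) 2)
    (hf : IsNewform0 f) : halfTranslate N 2 f = -f := by
  apply eq_of_forall_cuspCoeff_eq_gamma0
  intro n
  rw [cuspCoeff_halfTranslate_two h4 f n, cuspCoeff_neg_form (one_mem_strictPeriods_coe_gamma0 N) f n]
  rcases Nat.even_or_odd n with hn | hn
  · rw [Literature.NumberTheory.Automorphic.IsNewform0.cuspCoeff_eq_zero_of_two_dvd hf h4 (even_iff_two_dvd.mp hn),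
      mul_zero, neg_zero]
  · rw [hn.neg_one_pow, neg_one_mul]

/-- **`f ∣₂ t = −f` pointwise** for a newform at `4 ∣ N` (`t = (2 1; 0 2)`; at weight `2` the one-term formula
`t f = 4^{1−k/2} (f ∣ t)` has factor `1`). [cite: AtkinLehner1970, Lemma 27] -/
theorem slash_halfTranslateGL_eq_neg {N : ℕ} [NeZero N] (h4 : 4 ∣ N) (f : CuspForm (Gamma0 N) 2)
    (hf : IsNewform0 f) : (⇑f ∣[(2 : ℤ)] glCast (halfTranslateGL : GL (Fin 2) ℚ)) = -⇑f := by
  have h := coe_halfTranslate_eq_slash h4 f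
  rw [halfTranslate_two_eq_neg_of_isNewform0 h4 f hf] at h
  have h1 : (((4 : ℝ) ^ (1 - ((2 : ℤ) : ℝ) / 2) : ℝ) : ℂ) = 1 := by norm_num
  rw [h1, one_smul] at h
  rw [← h]
  rfl

/-- **The cube of `τ = w(4)·t` is a scalar multiple of an element of `Γ₀(4M)`** (`M` odd, `w(4) = (4x, y; 4M, 4)`
with `4x − My = 1`, `t = (2 1; 0 2)`): `(w(4) t)³ = 64 · γ` with `γ ∈ Γ₀(4M)` (explicit integer entries in the proof).
(refuter-1 §R46: «(t w₄)³ ∈ ℚ^× Γ₀(4M)».) [folklore] -/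
theorem atkinLehnerW_mul_halfTranslateGL_cube {M : ℕ} [NeZero (4 * M)] (hM : Odd M)
    (hcop : Nat.Coprime 4 (4 * M / 4)) :
    ∃ γ : SL(2, ℤ), γ ∈ Gamma0 (4 * M) ∧
      glCast (atkinLehnerW (4 * M) 4 : GL (Fin 2) ℚ) * glCast (halfTranslateGL : GL (Fin 2) ℚ) *
          (glCast (atkinLehnerW (4 * M) 4 : GL (Fin 2) ℚ) * glCast (halfTranslateGL : GL (Fin 2) ℚ)) *
          (glCast (atkinLehnerW (4 * M) 4 : GL (Fin 2) ℚ) * glCast (halfTranslateGL : GL (Fin 2) ℚ)) =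
        tpD 64 * tpG 64 * mapGL ℝ γ := by
  obtain ⟨m', hm'⟩ := hM
  have hMz : (M : ℤ) = 2 * m' + 1 := by exact_mod_cast hm'
  have h4 : 4 ∣ 4 * M := dvd_mul_right 4 M
  have hdiv : 4 * M / 4 = M := Nat.mul_div_cancel_left M (by norm_num)
  set x : ℤ := atkinLehnerSL (4 * M) 4 0 0 with hx
  set y : ℤ := atkinLehnerSL (4 * M) 4 0 1 with hy
  have hbez : 4 * x - (M : ℤ) * y = 1 := by
    have h := atkinLehnerSL_bezout (4 * M) 4 hcop
    rw [hdiv] at h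
    exact_mod_cast h
  have hyodd : Odd y := by
    have hMy : Odd ((M : ℤ) * y) := ⟨2 * x - 1, by linear_combination -hbez⟩
    exact (Int.odd_mul.mp hMy).2
  obtain ⟨y', hy'⟩ := hyodd
  have hbez' : 4 * x - (2 * (m' : ℤ) + 1) * (2 * y' + 1) = 1 := by rw [← hMz, ← hy']; exact hbez
  -- the explicit `γ`
  let A : Matrix (Fin 2) (Fin 2) ℤ :=
    !![-3 - 2 * m' + 14 * x + 24 * x * m' + 8 * x * m' ^ 2 + 24 * x ^ 2 + 16 * x ^ 2 * m' + 8 * x ^ 3,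
        -1 + 3 * y' - m' + 20 * x + 8 * x * y' + 16 * x * m' + 4 * x * m' ^ 2 + 22 * x ^ 2 + 4 * x ^ 2 * y' +
          8 * x ^ 2 * m' + 4 * x ^ 3;
      16 + 56 * m' + 56 * m' ^ 2 + 16 * m' ^ 3 + 24 * x + 64 * x * m' + 32 * x * m' ^ 2 + 8 * x ^ 2 + 16 * x ^ 2 * m',
        21 + 50 * m' + 36 * m' ^ 2 + 8 * m' ^ 3 + 34 * x + 48 * x * m' + 16 * x * m' ^ 2 + 12 * x ^ 2 + 8 * x ^ 2 * m']
  have hdet : A.det = 1 := by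
    rw [Matrix.det_fin_two_of]
    linear_combination (24 + 36 * (m' : ℤ) + 12 * (m' : ℤ) ^ 2 + 100 * x + 120 * x * m' + 32 * x * m' ^ 2 +
      140 * x ^ 2 + 112 * x ^ 2 * m' + 16 * x ^ 2 * m' ^ 2 + 80 * x ^ 3 + 32 * x ^ 3 * m' + 16 * x ^ 4) * hbez'
  let γ : SL(2, ℤ) := ⟨A, hdet⟩
  have hγ : γ ∈ Gamma0 (4 * M) := by
    rw [Gamma0_mem]
    show ((16 + 56 * m' + 56 * m' ^ 2 + 16 * m' ^ 3 + 24 * x + 64 * x * m' + 32 * x * m' ^ 2 + 8 * x ^ 2 +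
      16 * x ^ 2 * m' : ℤ) : ZMod (4 * M)) = 0
    rw [ZMod.intCast_zmod_eq_zero_iff_dvd]
    refine ⟨4 + 6 * m' + 2 * m' ^ 2 + 6 * x + 4 * x * m' + 2 * x ^ 2, ?_⟩
    rw [hm']
    push_cast
    ring
  refine ⟨γ, hγ, ?_⟩
  have hbezR : 4 * (x : ℝ) - (2 * (m' : ℝ) + 1) * (2 * y' + 1) = 1 := by exact_mod_cast hbez'
  have hyR : ((y : ℤ) : ℝ) = 2 * (y' : ℝ) + 1 := by exact_mod_cast hy'
  have hNR : ((4 * M : ℕ) : ℝ) = 8 * (m' : ℝ) + 4 := by rw [hm']; push_cast; ring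
  apply Matrix.GeneralLinearGroup.ext
  intro i j
  simp only [Matrix.GeneralLinearGroup.coe_mul, val_glCast_atkinLehnerW (4 * M) 4 h4 hcop, val_glCast_halfTranslateGL,
    val_tpD, val_tpG, val_mapGL', ← hx, ← hy]
  rw [hyR, hNR]
  fin_cases i <;> fin_cases j <;>
    simp only [γ, A, Matrix.mul_apply, Fin.sum_univ_two, Matrix.map_apply,
      Matrix.of_apply, Matrix.cons_val', Matrix.cons_val_zero, Matrix.cons_val_one, Matrix.empty_val',
      Matrix.cons_val_fin_one, Fin.isValue, Fin.zero_eta, Fin.mk_one] <;> push_cast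
  · linear_combination (-192 - 128 * (m' : ℝ) - 256 * x) * hbezR
  · linear_combination (-192 - 64 * (y' : ℝ) - 64 * m' - 192 * x) * hbezR
  · linear_combination (-128 - 256 * (m' : ℝ)) * hbezR
  · linear_combination (-384 - 256 * (m' : ℝ) - 128 * x) * hbezR

/-- **E-an-44: `w₄ f = −f`** — the Atkin–Lehner involution at `Q = 4` acts by `−1` on every newform of level `4M`, `M` odd
(`λ₄ = −1` at `4 ∥ N`): `f ∣ w(4) = ε f`, `f ∣ t = −f`, `(w(4) t)³ = 64 γ`, `γ ∈ Γ₀(4M)` give `f = (−ε)³ f`.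
[cite: Knapp1993, Thm. 9.27] [cite: AtkinLehner1970, Thm. 3] -/
theorem atkinLehnerInvolution_four_eq_neg {M : ℕ} [NeZero (4 * M)] (hM : Odd M) (f : CuspForm (Gamma0 (4 * M)) 2)
    (hf : IsNewform0 f) : atkinLehnerInvolution (4 * M) 2 4 f = -f := by
  have h4 : 4 ∣ 4 * M := dvd_mul_right 4 M
  have hdiv : 4 * M / 4 = M := Nat.mul_div_cancel_left M (by norm_num)
  have hcop : Nat.Coprime 4 (4 * M / 4) := by
    rw [hdiv]
    obtain ⟨m', hm'⟩ := hM
    have h2 : Nat.Coprime 2 M := Nat.prime_two.coprime_iff_not_dvd.mpr (by omega)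
    simpa using h2.pow_left 2
  obtain ⟨γ, hγ, hcube⟩ := atkinLehnerW_mul_halfTranslateGL_cube hM hcop
  obtain ⟨ε, hε1, hε⟩ := hf.exists_atkinLehnerInvolution_eq_smul h4 hcop
  set W : GL (Fin 2) ℝ := glCast (atkinLehnerW (4 * M) 4 : GL (Fin 2) ℚ) with hW
  set T : GL (Fin 2) ℝ := glCast (halfTranslateGL : GL (Fin 2) ℚ) with hT
  have hslW : (⇑f ∣[(2 : ℤ)] W) = ε • (⇑f : ℍ → ℂ) := by
    ext z
    rw [hW, slash_atkinLehnerW_apply h4 hcop hε z, Pi.smul_apply, smul_eq_mul]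
  have hslT : (⇑f ∣[(2 : ℤ)] T) = -(⇑f : ℍ → ℂ) := slash_halfTranslateGL_eq_neg h4 f hf
  have hdetT : 0 < T.det.val := by
    rw [hT, Matrix.GeneralLinearGroup.val_det_apply, val_glCast_halfTranslateGL, Matrix.det_fin_two_of]
    norm_num
  set A : GL (Fin 2) ℝ := W * T with hA
  clear_value A
  have hτ : (⇑f ∣[(2 : ℤ)] A) = (-ε) • (⇑f : ℍ → ℂ) := by
    rw [hA, SlashAction.slash_mul, hslW, ModularForm.smul_slash, σ_eq_self hdetT, hslT, smul_neg]
    exact (neg_smul ε (⇑f : ℍ → ℂ)).symm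
  have hdetA : 0 < A.det.val := by
    rw [hA, map_mul, Units.val_mul, hW, det_glCast_atkinLehnerW]
    exact mul_pos (by norm_num) hdetT
  have hε2 : ε * ε = 1 := by rcases hε1 with rfl | rfl <;> norm_num
  have hτ3 : (⇑f ∣[(2 : ℤ)] (A * A * A)) = (-ε) • (⇑f : ℍ → ℂ) := by
    rw [SlashAction.slash_mul, SlashAction.slash_mul, hτ, ModularForm.smul_slash, σ_eq_self hdetA, hτ, smul_smul,
      ModularForm.smul_slash, σ_eq_self hdetA, hτ, smul_smul]
    congr 1
    linear_combination (-ε) * hε2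
  have hfix : (⇑f ∣[(2 : ℤ)] (A * A * A)) = (⇑f : ℍ → ℂ) := by
    rw [hcube, SlashAction.slash_mul, slash_tpD_mul_tpG 64 2 ⇑f, sub_self, zpow_zero, one_smul]
    exact SlashInvariantFormClass.slash_action_eq f _ (Subgroup.mem_map_of_mem (mapGL ℝ) hγ)
  rw [hfix] at hτ3
  -- `⇑f = (−ε) • ⇑f` with `f ≠ 0` forces `ε = −1`
  rcases hε1 with rfl | rfl
  · exfalso
    apply hf.coe_ne_zero
    have h2 : (2 : ℂ) • (⇑f : ℍ → ℂ) = 0 := by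
      rw [two_smul]
      nth_rewrite 2 [hτ3]
      rw [neg_one_smul, add_neg_cancel]
    exact (smul_eq_zero.mp h2).resolve_left two_ne_zero
  · rw [hε, neg_one_smul]

end Summit.BirchSwinnertonDyer.BirchSwinnertonDyer.Theorems.ManinLocalTwoThree

end
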